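import Mathlib.Data.Nat.Factorial.BigOperators
import Mathlib.Data.Nat.Log
import Literature.Computability.AlgebraicComplexity.Forbes15ShiftedPartials
import HarnessLib

/-!
# Forbes 2015, Prop. 6.5 (`m = 1`) — the support of the trailing monomial is `O_t(log s)`

M. A. Forbes, *Deterministic divisibility testing via shifted partial derivatives*, FOCS 2015
(doi:10.1109/FOCS.2015.35; held `paper:doi-10-1109-focs-2015-35`), Prop. 6.5 and Appendix A
(Lemma A.3–A.6, the binomial estimates).

From the measure inequality `C(n,k)·C(n−k+ℓ,ℓ) ≤ s(k+1)·C(n+tk+ℓ, tk+ℓ)` (all `k ≤ n`, `ℓ`;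
`Forbes15ShiftedPartials.choose_mul_choose_le`) we derive `n < 9(t+2)3^t·(⌊log₂ s⌋ + 1)` by the
choice `k = ⌊log₂ s⌋ + 1`, `ℓ = t·n` and elementary estimates (ascending factorials; Forbes's
sharper analytic choice `k = n/(e³t)`, `ℓ = (t−1)(n+(t−1)k)` gives `n ≤ 2e³(t+1)(ln s + 2)`; the
typed FSV Lemma 36 only asks for SOME constant `c_t`, so we trade the constant for a proof in `ℕ`).

* `pow_le_choose_mul_pow` — `n^k ≤ C(n,k)·k^k`.
* `measureIneq_expand` — the measure inequality implies
  `n^k (ℓ+1)^{tk} (n−k+1)^k ≤ s(k+1) k^k (n+tk+ℓ)^{(t+1)k}` (Lemma A.3's regrouping, in `ℕ`).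
* `key_estimate` — for `n ≥ 9(t+2)3^t·k`, `ℓ = tn`: `4^k k^k (n+tk+tn)^{(t+1)k} ≤ n^k (tn+1)^{tk} (n−k+1)^k`.
* **`card_lt_of_isTrailing`** — Prop. 6.5 (`m = 1`) in the core form: `n` variables, trailing
  monomial of full support with exponents nonzero in `F` ⇒ `n < 9(t+2)3^t (⌊log₂ s⌋ + 1)`.

All theorems; no named facts.
-/

open MvPolynomial Finset
open scoped Nat

namespace Literature.Computability.AlgebraicComplexity.Forbes15

/-! ### Arithmetic -/

/-- `n^k ≤ C(n,k)·k^k` for `k ≤ n` (termwise `n·(k−j) ≤ (n−j)·k`).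
[cite: Forbes2015, Lemma A.3 («ln C(n,k) ≥ k ln(n/k)»)] -/
theorem pow_le_choose_mul_pow {n k : ℕ} (hk : k ≤ n) : n ^ k ≤ n.choose k * k ^ k := by
  have hfac : 0 < k ! := Nat.factorial_pos k
  suffices h : n ^ k * k ! ≤ n.choose k * k ^ k * k ! from Nat.le_of_mul_le_mul_right h hfac
  have h1 : n.choose k * k ! = n.descFactorial k := by
    rw [Nat.descFactorial_eq_factorial_mul_choose, mul_comm]
  have h2 : (k)! = ∏ i ∈ range k, (k - i) := by
    rw [← prod_range_add_one_eq_factorial, ← prod_range_reflect]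
    refine prod_congr rfl fun i hi => ?_
    rw [mem_range] at hi
    omega
  calc n ^ k * k ! = ∏ i ∈ range k, n * (k - i) := by
        rw [h2, prod_mul_distrib, prod_const, card_range]
    _ ≤ ∏ i ∈ range k, (n - i) * k := by
        refine prod_le_prod' fun i hi => ?_
        rw [mem_range] at hi
        obtain ⟨a, rfl⟩ := Nat.exists_eq_add_of_le hi.le
        obtain ⟨b, hb⟩ := Nat.exists_eq_add_of_le (hi.le.trans hk)
        rw [hb, Nat.add_sub_cancel_left, Nat.add_sub_cancel_left]
        have hab : a ≤ b := by omega
        nlinarith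
    _ = n.choose k * k ^ k * k ! := by
        rw [prod_mul_distrib, prod_const, card_range, ← Nat.descFactorial_eq_prod_range, ← h1]
        ring

/-- **Regrouping the measure inequality (Forbes Lemma A.3's factorial bookkeeping, in `ℕ`):**
`C(n,k)·C(n−k+ℓ,ℓ) ≤ s(k+1)·C(n+tk+ℓ, tk+ℓ)` implies
`n^k·(ℓ+1)^{tk}·(n−k+1)^k ≤ s·(k+1)·k^k·(n+tk+ℓ)^{(t+1)k}`.
[cite: Forbes2015, Lemma A.3, Lemma A.4] -/
theorem measureIneq_expand {n k t ℓ s : ℕ} (hk : k ≤ n)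
    (h : n.choose k * (n - k + ℓ).choose ℓ ≤ s * (k + 1) * (n + (t * k + ℓ)).choose (t * k + ℓ)) :
    n ^ k * (ℓ + 1) ^ (t * k) * (n - k + 1) ^ k ≤
      s * (k + 1) * k ^ k * (n + (t * k + ℓ)) ^ ((t + 1) * k) := by
  set N := n - k with hN
  set M := t * k + ℓ with hM
  have hnN : n = N + k := by omega
  -- the ascending factorials involved
  have f1 : ℓ ! * (N + ℓ).choose ℓ = (N + 1).ascFactorial ℓ :=
    (Nat.ascFactorial_eq_factorial_mul_choose N ℓ).symm
  have f2 : M ! * (n + M).choose M = (n + 1).ascFactorial M :=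
    (Nat.ascFactorial_eq_factorial_mul_choose n M).symm
  have f3 : ℓ ! * (ℓ + 1).ascFactorial (t * k) = M ! := by
    rw [Nat.factorial_mul_ascFactorial, hM, add_comm]
  have e1 : (N + 1).ascFactorial ℓ * (N + 1 + ℓ).ascFactorial ((t + 1) * k) =
      (N + 1).ascFactorial k * (n + 1).ascFactorial M := by
    rw [Nat.ascFactorial_mul_ascFactorial, hnN, show N + k + 1 = N + 1 + k by ring,
      Nat.ascFactorial_mul_ascFactorial]
    congr 1
    rw [hM]; ring
  have hRpos : 0 < (N + 1).ascFactorial ℓ := Nat.ascFactorial_pos N ℓ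
  -- multiply `h` by `ℓ! · (ℓ+1)^{(tk)} · (N+1)^{(k)}` and cancel `(N+1)^{(ℓ)}`
  have h2 : n.choose k * (ℓ + 1).ascFactorial (t * k) * (N + 1).ascFactorial k ≤
      s * (k + 1) * (N + 1 + ℓ).ascFactorial ((t + 1) * k) := by
    refine Nat.le_of_mul_le_mul_right (c := (N + 1).ascFactorial ℓ) ?_ hRpos
    have := Nat.mul_le_mul_right (ℓ ! * (ℓ + 1).ascFactorial (t * k) * (N + 1).ascFactorial k) h
    calc n.choose k * (ℓ + 1).ascFactorial (t * k) * (N + 1).ascFactorial k *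
          (N + 1).ascFactorial ℓ
        = n.choose k * (N + ℓ).choose ℓ *
            (ℓ ! * (ℓ + 1).ascFactorial (t * k) * (N + 1).ascFactorial k) := by
          rw [← f1]; ring
      _ ≤ s * (k + 1) * (n + M).choose M *
            (ℓ ! * (ℓ + 1).ascFactorial (t * k) * (N + 1).ascFactorial k) := this
      _ = s * (k + 1) * ((N + 1).ascFactorial k * (n + 1).ascFactorial M) := by
          rw [f3, ← f2]; ring
      _ = s * (k + 1) * (N + 1 + ℓ).ascFactorial ((t + 1) * k) * (N + 1).ascFactorial ℓ := by
          rw [← e1]; ring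
  -- elementary bounds on the ascending factorials
  have b1 : (ℓ + 1) ^ (t * k) ≤ (ℓ + 1).ascFactorial (t * k) := Nat.pow_succ_le_ascFactorial _ _
  have b2 : (N + 1) ^ k ≤ (N + 1).ascFactorial k := Nat.pow_succ_le_ascFactorial _ _
  have b3 : (N + 1 + ℓ).ascFactorial ((t + 1) * k) ≤ (n + M) ^ ((t + 1) * k) := by
    have := Nat.ascFactorial_le_pow_add (N + ℓ) ((t + 1) * k)
    rw [show N + ℓ + 1 = N + 1 + ℓ by ring] at this
    refine this.trans (le_of_eq ?_)
    congr 1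
    rw [hnN, hM]; ring
  have b4 : n ^ k ≤ n.choose k * k ^ k := pow_le_choose_mul_pow hk
  calc n ^ k * (ℓ + 1) ^ (t * k) * (N + 1) ^ k
      ≤ (n.choose k * k ^ k) * (ℓ + 1).ascFactorial (t * k) * (N + 1).ascFactorial k :=
        Nat.mul_le_mul (Nat.mul_le_mul b4 b1) b2
    _ = k ^ k * (n.choose k * (ℓ + 1).ascFactorial (t * k) * (N + 1).ascFactorial k) := by ring
    _ ≤ k ^ k * (s * (k + 1) * (N + 1 + ℓ).ascFactorial ((t + 1) * k)) :=
        Nat.mul_le_mul_left _ h2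
    _ ≤ k ^ k * (s * (k + 1) * (n + M) ^ ((t + 1) * k)) :=
        Nat.mul_le_mul_left _ (Nat.mul_le_mul_left _ b3)
    _ = s * (k + 1) * k ^ k * (n + M) ^ ((t + 1) * k) := by ring

/-- `(t+2)^t ≤ 3^t·t^t`. [cite: Forbes2015, Lemma A.6 (parameter estimate)] -/
theorem add_two_pow_le (t : ℕ) : (t + 2) ^ t ≤ 3 ^ t * t ^ t := by
  rcases Nat.eq_zero_or_pos t with rfl | ht
  · simp
  · rw [← mul_pow]
    exact Nat.pow_le_pow_left (by omega) t

/-- **The parameter choice** (`k ≥ 1`, `ℓ = tn`, `n ≥ 9(t+2)3^t·k`):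
`4^k·k^k·(n+tk+tn)^{(t+1)k} ≤ n^k·(tn+1)^{tk}·(n−k+1)^k`.
[cite: Forbes2015, Lemma A.6 (parameter choice; ours is cruder)] -/
theorem key_estimate {n k t : ℕ} (hn : 9 * (t + 2) * 3 ^ t * k ≤ n) :
    4 ^ k * k ^ k * (n + (t * k + t * n)) ^ ((t + 1) * k) ≤
      n ^ k * (t * n + 1) ^ (t * k) * (n - k + 1) ^ k := by
  have htk : t * k ≤ n := by
    have : t ≤ 9 * (t + 2) * 3 ^ t := by
      have h3 : 1 ≤ 3 ^ t := Nat.one_le_pow _ _ (by norm_num)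
      nlinarith
    exact le_trans (Nat.mul_le_mul_right k this) hn
  have hkn : k ≤ n := le_trans (Nat.le_mul_of_pos_left k (by positivity)) hn
  -- base inequality, then raise to the `k`-th power
  have base : 4 * k * (n + (t * k + t * n)) ^ (t + 1) ≤ n * (t * n + 1) ^ t * (n - k + 1) := by
    have s1 : n + (t * k + t * n) ≤ (t + 2) * n := by nlinarith
    have s2 : (n + (t * k + t * n)) ^ (t + 1) ≤ (t + 2) ^ (t + 1) * n ^ (t + 1) := by
      rw [← mul_pow]; exact Nat.pow_le_pow_left s1 _
    have s3 : 4 * k * (t + 2) * 3 ^ t ≤ n - k + 1 := by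
      have : 4 * k * (t + 2) * 3 ^ t + k ≤ 9 * (t + 2) * 3 ^ t * k := by
        have h3 : k ≤ 3 ^ t * k := Nat.le_mul_of_pos_left k (Nat.one_le_pow _ _ (by norm_num))
        have h4 : 0 ≤ k * t * 3 ^ t := Nat.zero_le _
        nlinarith [h3, h4]
      omega
    have s4 : (t * n) ^ t ≤ (t * n + 1) ^ t := Nat.pow_le_pow_left (Nat.le_succ _) t
    calc 4 * k * (n + (t * k + t * n)) ^ (t + 1)
        ≤ 4 * k * ((t + 2) ^ (t + 1) * n ^ (t + 1)) := Nat.mul_le_mul_left _ s2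
      _ = (4 * k * (t + 2)) * (t + 2) ^ t * n ^ (t + 1) := by ring
      _ ≤ (4 * k * (t + 2)) * (3 ^ t * t ^ t) * n ^ (t + 1) :=
          Nat.mul_le_mul_right _ (Nat.mul_le_mul_left _ (add_two_pow_le t))
      _ = (4 * k * (t + 2) * 3 ^ t) * (t ^ t * n ^ (t + 1)) := by ring
      _ ≤ (n - k + 1) * (t ^ t * n ^ (t + 1)) := Nat.mul_le_mul_right _ s3
      _ = n * (t * n) ^ t * (n - k + 1) := by ring
      _ ≤ n * (t * n + 1) ^ t * (n - k + 1) :=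
          Nat.mul_le_mul_right _ (Nat.mul_le_mul_left _ s4)
  have := Nat.pow_le_pow_left base k
  calc 4 ^ k * k ^ k * (n + (t * k + t * n)) ^ ((t + 1) * k)
      = (4 * k * (n + (t * k + t * n)) ^ (t + 1)) ^ k := by
        rw [mul_pow, mul_pow, ← pow_mul]
    _ ≤ (n * (t * n + 1) ^ t * (n - k + 1)) ^ k := this
    _ = n ^ k * (t * n + 1) ^ (t * k) * (n - k + 1) ^ k := by
        rw [mul_pow, mul_pow, ← pow_mul]

/-- **From the measure inequality (for all `k ≤ n`, `ℓ`) to the bound on `n`.**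
[cite: Forbes2015, Prop. 6.5 / Lemma A.6] -/
theorem lt_of_measureIneq {n t s : ℕ}
    (h : ∀ k ℓ : ℕ, k ≤ n →
      n.choose k * (n - k + ℓ).choose ℓ ≤ s * (k + 1) * (n + (t * k + ℓ)).choose (t * k + ℓ)) :
    n < 9 * (t + 2) * 3 ^ t * (Nat.log 2 s + 1) := by
  by_contra hcon
  push Not at hcon
  set k := Nat.log 2 s + 1 with hk
  have hs : s < 2 ^ k := Nat.lt_pow_succ_log_self (by norm_num) s
  have hk1 : 1 ≤ k := by omega
  have hkn : k ≤ n := le_trans (Nat.le_mul_of_pos_left k (by positivity)) hcon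
  have hn1 : 1 ≤ n := hk1.trans hkn
  have h1 := measureIneq_expand hkn (h k (t * n) hkn)
  have h2 := key_estimate hcon
  have hk2 : k + 1 ≤ 2 ^ k := Nat.succ_le_of_lt k.lt_two_pow_self
  have hX : 0 < k ^ k * (n + (t * k + t * n)) ^ ((t + 1) * k) := by positivity
  have h3 : s * (k + 1) * k ^ k * (n + (t * k + t * n)) ^ ((t + 1) * k) <
      4 ^ k * k ^ k * (n + (t * k + t * n)) ^ ((t + 1) * k) := by
    have h4 : s * (k + 1) < 2 ^ k * 2 ^ k :=
      lt_of_lt_of_le (Nat.mul_lt_mul_of_lt_of_le hs le_rfl (by omega))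
        (Nat.mul_le_mul_left _ hk2)
    have h5 : (4 : ℕ) ^ k = 2 ^ k * 2 ^ k := by
      rw [← mul_pow]; norm_num
    rw [h5, mul_assoc (s * (k + 1)), mul_assoc (2 ^ k * 2 ^ k)]
    exact Nat.mul_lt_mul_of_lt_of_le h4 le_rfl hX
  exact absurd (h1.trans_lt h3) (not_lt.mpr h2)

/-! ### Prop. 6.5 (`m = 1`), core form -/

variable {F Λ : Type*} [Field F] [AddCommMonoid Λ] [LinearOrder Λ] [IsOrderedCancelAddMonoid Λ]

/-- **Forbes 2015, Prop. 6.5 with `m = 1` (core form).** Let `g = Σ_{i<s} u_i·G_i^{d_i}` over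
`n` variables, where each `u_i` is log-affine for a full-support shift `α` (e.g.
`u_i = λ_i (x+α)^{a_i}`) and `deg G_i ≤ t`; if the trailing monomial `a` of `g` (for an additive
injective monotone rank `r`) involves ALL `n` variables with exponents nonzero in `F` — the
characteristic hypothesis «char(F) > ideg x^a» of the source — then `n < 9(t+2)3^t·(⌊log₂ s⌋+1)`
(print: `‖a‖₀ ≤ 2e³(t+1)(ln s + m ln 2m + 1)`). [cite: Forbes2015, Prop. 6.5] -/
theorem card_lt_of_isTrailing {n s t : ℕ} {r : (Fin n →₀ ℕ) →+ Λ} (hr : Function.Injective r)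
    (hmono : Monotone r) {α : Fin n → F} (hα : ∀ i, α i ≠ 0)
    {u G : Fin s → MvPolynomial (Fin n) F} {d : Fin s → ℕ} (hu : ∀ i, LogAffine α (u i))
    (hG : ∀ i, (G i).totalDegree ≤ t) {a : Fin n →₀ ℕ}
    (hg : IsTrailing r (∑ i, u i * G i ^ d i) a) (ha : ∀ i, (a i : F) ≠ 0) :
    n < 9 * (t + 2) * 3 ^ t * (Nat.log 2 s + 1) :=
  lt_of_measureIneq fun k ℓ _ => choose_mul_choose_le hr hmono hα hu hG hg ha k ℓ

end Literature.Computability.AlgebraicComplexity.Forbes15
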